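import Literature.MathematicalPhysics.QuantumManyBody.PeriodicConfigFourier
import Literature.Analysis.InnerProduct.CompactEmbeddingKyFanTwo
import Mathlib.MeasureTheory.Function.ConvergenceInMeasure
import Mathlib.Analysis.InnerProductSpace.PiL2
import HarnessLib

/-!
# The form domain of the periodic `N`-body Hamiltonian: a Hilbert space compactly embedded in `L²`

Topic `Literature/MathematicalPhysics/QuantumManyBody`, sequel of `PeriodicConfigFourier.lean`, written
for the provefact `Literature.MathematicalPhysics.QuantumManyBody.BoseGas.BoccatoEtAl2019Acta_firstExcitation`
([BoccatoEtAl2019Acta, Thm. 1.1]; the min–max step §6 of its proof). The tree states the spectral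
quantities of the periodic `N`-body Hamiltonian `H = ∑ⱼ -Δⱼ + ∑_{i<j} v^per(xᵢ - xⱼ)` on the torus
`(ℝ³/Lℤ³)^N` VARIATIONALLY over the `C¹` Bose-symmetric periodic core `PeriodicTrialState N L`
(`periodicEnergy`, `periodicGroundStateEnergy`, `kyFanTwo`, `momentumSectorEnergy`, …). This file
constructs the object that turns these infima into eigenvalues: the **form domain** `Q` of the
quadratic form `q(Ψ) = ∫_{[0,L)^{3N}} |∇Ψ|² + W|Ψ|²`, `W = ∑_{i<j} v^per(xᵢ - xⱼ)`
(`periodicInteraction v L`), as a Hilbert space together with its embedding `ι : Q →L[ℂ] L²` — in the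
abstract format of `Literature.Analysis.InnerProduct.CompactEmbeddingKyFanTwo` (closed semibounded
forms = Hilbert spaces `Q` with an injective bounded `ι`; compact resolvent = `ι` compact
[ReedSimonIV1978, Thm. XIII.64]).

**Construction (the graph of the form).** Let `𝒞 = periodicCore N L` be the `ℂ`-subspace of `C¹`,
`Lℤ³`-periodic (in every particle), Bose-symmetric functions `(ℝ³)^N → ℂ`, and assume
`W ∈ L¹([0,L)^{3N})` (true for `v(|·|) ∈ L¹(ℝ³)`, e.g. the `L³` compactly supported potentials of
[BoccatoEtAl2019Acta]; hard cores are NOT covered here). With `H = L²((ℝ/ℤ)^{3N})` (Haar probability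
measure) and the scaled transport `Ψ ↦ L^{3N/2} Ψ ∘ fromUnitTorusN L` of `PeriodicConfigFourier.lean`,
the **graph embedding** `graphEmbed : 𝒞 →ₗ[ℂ] ⨁_c H` (`PiLp 2` over the component index
`CompIdx N = {val} ⊔ {grad (i,k)} ⊔ {pot}`) sends `Ψ` to the `L²` classes of
`L^{3N/2}(Ψ, (∂_{i,k}Ψ)_{i,k}, √W Ψ) ∘ fromUnitTorusN L`, so that (`norm_graphEmbed_sq`)
`‖graphEmbed Ψ‖² = ∫_{[0,L)^{3N}} |Ψ|² + ∫_{[0,L)^{3N}} (|∇Ψ|² + W|Ψ|²)`, the second term being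
`periodicEnergy` for a normalised state (`norm_graphEmbed_sq_trialState`). The **form domain**
`formDomain = closure (range graphEmbed)` is a closed subspace, hence a Hilbert space, and
`formEmbed = (first component) ∘ subtype : formDomain →L[ℂ] H` is the embedding `ι`, with
`‖ι(graphEmbed Ψ)‖² = ∫_{[0,L)^{3N}} |Ψ|²` and `⟪ι(graphEmbed Ψ), ι(graphEmbed Φ)⟫ = ∫ conj(Ψ) Φ`
(`norm_formEmbed_graphEmbed_sq`, `inner_formEmbed_graphEmbed`).

**Main results.**
* `formEmbed_injective` — **closability of the form** on the core `𝒞`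
  [ReedSimonI1980, §VIII.6]: if `graphEmbed Ψⱼ → ξ` and `Ψⱼ → 0` in `L²` then `ξ = 0`.
  The potential component vanishes along an a.e.-convergent subsequence
  (`TendstoInMeasure.exists_seq_tendsto_ae`); the gradient components vanish because their Fourier
  coefficients are `(2πi n_{i,k}/L)` times those of `Ψⱼ` (`configFourierCoeff_fderiv`) and the
  Fourier coefficients separate `L²((ℝ/ℤ)^{3N})` (`UnitAddTorus.mFourierBasis`).
* `isCompactOperator_formEmbed` — **Rellich's lemma for the form** (`H` has compact resolvent):
  `ι` is the operator-norm limit of the finite-rank Fourier truncations `T_R ∘ ι`, with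
  `‖ι ξ - T_R ι ξ‖ ≤ (L/2πR) ‖ξ‖` from the spectral kinetic energy
  (`tsum_sq_mul_sq_configFourierCoeff`) [ReedSimonIV1978, Thm. XIII.64 and XIII.73 (periodic b.c.)].
* `dense_coreRange` — `𝒞` is dense in `Q` (a form core, by construction).
Consequently `Literature.Analysis.InnerProduct.exists_twoModeData` applies to `formEmbed`; the
identification of `periodicGroundStateEnergy` and `kyFanTwo` with the two lowest form eigenvalues
is carried out in `PeriodicFormSpectrum.lean`.

## References
* [BoccatoEtAl2019Acta] Boccato–Brennecke–Cenatiempo–Schlein, Acta Math. 222 (2019), §6 (min–max for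
  `H_N` on `L²_s(Λ^N)`).
* [ReedSimonIV1978] Reed–Simon IV, Thm. XIII.64 (compact resolvent ⇔ compact form embedding),
  XIII.73–XIII.74 (`-Δ` with periodic boundary conditions has compact resolvent).
* [ReedSimonI1980] Reed–Simon I, §VIII.6 (closed and closable forms, form cores).
-/

noncomputable section

open MeasureTheory Filter Set WithLp Complex UnitAddTorus
open scoped ENNReal NNReal Topology ComplexConjugate InnerProductSpace

namespace Literature.MathematicalPhysics.QuantumManyBody.BoseGas

/-- As in `PeriodicConfigFourier.lean`: the measure on `ℝ/ℤ` is the Haar probability measure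
(local instance, definitionally that of `PeriodicBoseGasFourier.lean`). [folklore] -/
local instance formDomain_measureSpace : MeasureSpace UnitAddCircle := ⟨AddCircle.haarAddCircle⟩

/-- The measure on `ℝ/ℤ` is a probability measure. [folklore] -/
local instance formDomain_isProbabilityMeasure : IsProbabilityMeasure (volume : Measure UnitAddCircle) :=
  inferInstanceAs (IsProbabilityMeasure AddCircle.haarAddCircle)

/-- The measure on `(ℝ/ℤ)^D` is a probability measure. [folklore] -/
local instance formDomain_isProbabilityMeasure_pi {D : Type*} [Fintype D] :
    IsProbabilityMeasure (volume : Measure (UnitAddTorus D)) := by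
  rw [volume_pi]; infer_instance

variable {N : ℕ} {L : ℝ} {v : ℝ → ℝ≥0∞}

/-- Local notation for the Hilbert space `H = L²((ℝ/ℤ)^{3N})`. -/
local notation "L2T " N':max => Lp ℂ 2 (volume : Measure (UnitAddTorus (Fin N' × Fin 3)))

/-! ### The core `𝒞` -/

/-- The **core** `𝒞`: the `ℂ`-subspace of `C¹`, `Lℤ³`-periodic (in every particle), Bose-symmetric
functions `(ℝ³)^N → ℂ` — exactly the functions underlying `PeriodicTrialState N L` (which are in
addition normalised on the cell). [cite: ReedSimonI1980, §VIII.6 (form core)] -/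
def periodicCore (N : ℕ) (L : ℝ) : Submodule ℂ (Config N → ℂ) where
  carrier := {Ψ | ContDiff ℝ 1 Ψ ∧ IsTorusPeriodic L Ψ ∧
    ∀ (σ : Equiv.Perm (Fin N)) (X : Config N), Ψ (X ∘ σ) = Ψ X}
  zero_mem' := ⟨contDiff_const, fun _ _ _ => rfl, fun _ _ => rfl⟩
  add_mem' := by
    rintro Ψ Φ ⟨hΨ1, hΨ2, hΨ3⟩ ⟨hΦ1, hΦ2, hΦ3⟩
    exact ⟨hΨ1.add hΦ1, fun X i k => by simp only [Pi.add_apply, hΨ2 X i k, hΦ2 X i k],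
      fun σ X => by simp only [Pi.add_apply, hΨ3 σ X, hΦ3 σ X]⟩
  smul_mem' := by
    rintro c Ψ ⟨h1, h2, h3⟩
    exact ⟨contDiff_const.smul h1, fun X i k => by simp only [Pi.smul_apply, h2 X i k],
      fun σ X => by simp only [Pi.smul_apply, h3 σ X]⟩

/-- Membership in the core. [folklore] -/
theorem mem_periodicCore {Ψ : Config N → ℂ} :
    Ψ ∈ periodicCore N L ↔ ContDiff ℝ 1 Ψ ∧ IsTorusPeriodic L Ψ ∧
      ∀ (σ : Equiv.Perm (Fin N)) (X : Config N), Ψ (X ∘ σ) = Ψ X := Iff.rfl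

/-- The wave function of a periodic trial state lies in the core. [folklore] -/
theorem PeriodicTrialState.mem_periodicCore (Ψ : PeriodicTrialState N L) : Ψ.ψ ∈ periodicCore N L :=
  ⟨Ψ.contDiff, Ψ.periodic, Ψ.symm⟩

/-! ### The components of the graph embedding -/

/-- The component index of the graph of the form: the function itself, its `3N` partial
derivatives, and `√W` times the function. [folklore] -/
abbrev CompIdx (N : ℕ) : Type := Unit ⊕ ((Fin N × Fin 3) ⊕ Unit)

/-- The configuration-space components `(Ψ, (∂_{i,k}Ψ)_{i,k}, √W Ψ)` of the graph of the form
`q(Ψ) = ∫ |∇Ψ|² + W|Ψ|²`, `W = periodicInteraction v L`. [folklore] -/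
def compFun (v : ℝ → ℝ≥0∞) (L : ℝ) (Ψ : Config N → ℂ) : CompIdx N → Config N → ℂ
  | Sum.inl _ => Ψ
  | Sum.inr (Sum.inl p) => fun X => fderiv ℝ Ψ X (Pi.single p.1 (EuclideanSpace.single p.2 1))
  | Sum.inr (Sum.inr _) => fun X => ((Real.sqrt (periodicInteraction v L X).toReal : ℝ) : ℂ) * Ψ X

/-- The value component. [folklore] -/
@[simp] theorem compFun_val (v : ℝ → ℝ≥0∞) (L : ℝ) (Ψ : Config N → ℂ) (u : Unit) :
    compFun v L Ψ (Sum.inl u) = Ψ := rfl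

/-- The gradient components. [folklore] -/
@[simp] theorem compFun_grad (v : ℝ → ℝ≥0∞) (L : ℝ) (Ψ : Config N → ℂ) (p : Fin N × Fin 3) :
    compFun v L Ψ (Sum.inr (Sum.inl p)) =
      fun X => fderiv ℝ Ψ X (Pi.single p.1 (EuclideanSpace.single p.2 1)) := rfl

/-- The potential component. [folklore] -/
@[simp] theorem compFun_pot (v : ℝ → ℝ≥0∞) (L : ℝ) (Ψ : Config N → ℂ) (u : Unit) :
    compFun v L Ψ (Sum.inr (Sum.inr u)) =
      fun X => ((Real.sqrt (periodicInteraction v L X).toReal : ℝ) : ℂ) * Ψ X := rfl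

/-- The components are additive on `C¹` functions. [folklore] -/
theorem compFun_add {Ψ Φ : Config N → ℂ} (hΨ : ContDiff ℝ 1 Ψ) (hΦ : ContDiff ℝ 1 Φ) (c : CompIdx N) :
    compFun v L (Ψ + Φ) c = compFun v L Ψ c + compFun v L Φ c := by
  rcases c with u | p | u
  · rfl
  · funext X
    simp only [compFun_grad, Pi.add_apply]
    rw [fderiv_add (hΨ.differentiable one_ne_zero X) (hΦ.differentiable one_ne_zero X)]
    rfl
  · funext X
    simp only [compFun_pot, Pi.add_apply, mul_add]

/-- The components are homogeneous on `C¹` functions. [folklore] -/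
theorem compFun_smul {Ψ : Config N → ℂ} (hΨ : ContDiff ℝ 1 Ψ) (a : ℂ) (c : CompIdx N) :
    compFun v L (a • Ψ) c = a • compFun v L Ψ c := by
  rcases c with u | p | u
  · rfl
  · funext X
    simp only [compFun_grad, Pi.smul_apply]
    rw [fderiv_const_smul (hΨ.differentiable one_ne_zero X)]
    rfl
  · funext X
    simp only [compFun_pot, Pi.smul_apply, smul_eq_mul]
    ring

/-- The periodic interaction is measurable (copy of the lemma of
`DiluteBoseGasUpperBoundLocalization.lean`, kept private to avoid that import). [folklore] -/
private theorem measurable_periodicInteraction' (hv : Measurable v) (L : ℝ) :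
    Measurable (periodicInteraction (N := N) v L) := by
  unfold periodicInteraction periodizedPotential
  refine Finset.measurable_sum _ fun i _ => Finset.measurable_sum _ fun j _ => ?_
  exact (Measurable.tsum fun n => hv.comp (measurable_id.sub_const _).norm).comp
    ((measurable_config_apply i).sub (measurable_config_apply j))

/-- `√W` is measurable. [folklore] -/
theorem measurable_sqrt_periodicInteraction (hv : Measurable v) (L : ℝ) :
    Measurable fun X : Config N => ((Real.sqrt (periodicInteraction v L X).toReal : ℝ) : ℂ) :=
  Complex.measurable_ofReal.comp ((measurable_periodicInteraction' hv L).ennreal_toReal.sqrt)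

/-- The components of a core function are measurable. [folklore] -/
theorem measurable_compFun (hv : Measurable v) {Ψ : Config N → ℂ} (hΨ : ContDiff ℝ 1 Ψ) (c : CompIdx N) :
    Measurable (compFun v L Ψ c) := by
  rcases c with u | p | u
  · exact hΨ.continuous.measurable
  · exact (continuous_fderiv_config_single hΨ p.1 p.2).measurable
  · exact (measurable_sqrt_periodicInteraction hv L).mul hΨ.continuous.measurable

/-- `‖√W‖₊² = ofReal W.toReal` (so `= W` where `W < ∞`, `= 0` where `W = ∞`). [folklore] -/
theorem coe_nnnorm_sqrt_sq (W : ℝ≥0∞) :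
    ((‖((Real.sqrt W.toReal : ℝ) : ℂ)‖₊ : ℝ≥0∞)) ^ 2 = ENNReal.ofReal W.toReal := by
  rw [coe_nnnorm_sq_eq_ofReal, Complex.norm_real, Real.norm_eq_abs, sq_abs,
    Real.sq_sqrt ENNReal.toReal_nonneg]

/-- `‖√W Ψ‖₊² ≤ W ‖Ψ‖₊²` pointwise. [folklore] -/
theorem nnnorm_sqrt_mul_sq_le (W : ℝ≥0∞) (z : ℂ) :
    ((‖((Real.sqrt W.toReal : ℝ) : ℂ) * z‖₊ : ℝ≥0∞)) ^ 2 ≤ W * (‖z‖₊ : ℝ≥0∞) ^ 2 := by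
  rw [nnnorm_mul, ENNReal.coe_mul, mul_pow, coe_nnnorm_sqrt_sq]
  exact mul_le_mul' ENNReal.ofReal_toReal_le le_rfl

/-- `‖√W Ψ‖₊² = W ‖Ψ‖₊²` where `W < ∞`. [folklore] -/
theorem nnnorm_sqrt_mul_sq_eq {W : ℝ≥0∞} (hW : W ≠ ⊤) (z : ℂ) :
    ((‖((Real.sqrt W.toReal : ℝ) : ℂ) * z‖₊ : ℝ≥0∞)) ^ 2 = W * (‖z‖₊ : ℝ≥0∞) ^ 2 := by
  rw [nnnorm_mul, ENNReal.coe_mul, mul_pow, coe_nnnorm_sqrt_sq, ENNReal.ofReal_toReal hW]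

/-- A continuous function is bounded on the cell `[0,L)^{3N}`. [folklore] -/
theorem exists_bound_on_cellN (L : ℝ) {E : Type*} [SeminormedAddCommGroup E] {Ψ : Config N → E}
    (hΨ : Continuous Ψ) : ∃ C, 0 ≤ C ∧ ∀ X ∈ cellN N L, ‖Ψ X‖ ≤ C := by
  obtain ⟨C, hC⟩ := (isCompact_closedBoxN N L).exists_bound_of_continuousOn hΨ.continuousOn
  refine ⟨max C 0, le_max_right _ _, fun X hX => (hC X (cellN_subset_closedBoxN N L hX)).trans (le_max_left _ _)⟩

/-- `∫_{[0,L)^{3N}} ‖Ψ‖₊² < ∞` for continuous `Ψ`. [folklore] -/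
theorem lintegral_cellN_sq_lt_top (L : ℝ) {Ψ : Config N → ℂ} (hΨ : Continuous Ψ) :
    ∫⁻ X in cellN N L, ((‖Ψ X‖₊ : ℝ≥0∞)) ^ 2 < ⊤ := by
  have h := (integrableOn_sq_cellN L hΨ).2
  rw [HasFiniteIntegral] at h
  refine lt_of_le_of_lt (lintegral_mono fun X => ?_) h
  rw [coe_nnnorm_sq_eq_ofReal, ← ofReal_norm, Real.norm_of_nonneg (by positivity)]

/-- `∫_{[0,L)^{3N}} W‖Ψ‖₊² < ∞` for continuous `Ψ` and `W ∈ L¹` of the cell. [folklore] -/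
theorem lintegral_cellN_pot_sq_lt_top {L : ℝ} (hW : ∫⁻ X in cellN N L, periodicInteraction v L X ≠ ⊤)
    {Ψ : Config N → ℂ} (hΨ : Continuous Ψ) :
    ∫⁻ X in cellN N L, periodicInteraction v L X * ((‖Ψ X‖₊ : ℝ≥0∞)) ^ 2 < ⊤ := by
  obtain ⟨C, hC0, hC⟩ := exists_bound_on_cellN L hΨ
  have hle : ∀ X ∈ cellN N L, periodicInteraction v L X * ((‖Ψ X‖₊ : ℝ≥0∞)) ^ 2 ≤
      periodicInteraction v L X * ENNReal.ofReal (C ^ 2) := fun X hX => by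
    gcongr
    rw [coe_nnnorm_sq_eq_ofReal]
    exact ENNReal.ofReal_le_ofReal (by nlinarith [hC X hX, norm_nonneg (Ψ X)])
  calc ∫⁻ X in cellN N L, periodicInteraction v L X * ((‖Ψ X‖₊ : ℝ≥0∞)) ^ 2
      ≤ ∫⁻ X in cellN N L, periodicInteraction v L X * ENNReal.ofReal (C ^ 2) :=
        setLIntegral_mono' (measurableSet_cellN N L) hle
    _ = (∫⁻ X in cellN N L, periodicInteraction v L X) * ENNReal.ofReal (C ^ 2) :=
        lintegral_mul_const' _ _ ENNReal.ofReal_ne_top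
    _ < ⊤ := ENNReal.mul_lt_top hW.lt_top ENNReal.ofReal_lt_top

/-- The squared components of a core function have finite integral over the cell. [folklore] -/
theorem lintegral_cellN_compFun_sq_lt_top (hW : ∫⁻ X in cellN N L, periodicInteraction v L X ≠ ⊤)
    {Ψ : Config N → ℂ} (hΨ : ContDiff ℝ 1 Ψ) (c : CompIdx N) :
    ∫⁻ X in cellN N L, ((‖compFun v L Ψ c X‖₊ : ℝ≥0∞)) ^ 2 < ⊤ := by
  rcases c with u | p | u
  · exact lintegral_cellN_sq_lt_top L hΨ.continuous
  · exact lintegral_cellN_sq_lt_top L (continuous_fderiv_config_single hΨ p.1 p.2)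
  · refine lt_of_le_of_lt (lintegral_mono fun X => ?_) (lintegral_cellN_pot_sq_lt_top hW hΨ.continuous)
    exact nnnorm_sqrt_mul_sq_le _ _

/-- `‖f‖ₑ² = ‖f‖₊²` with natural-number exponent versus real exponent `2`. [folklore] -/
theorem enorm_rpow_two_eq_coe_nnnorm_sq {E : Type*} [SeminormedAddCommGroup E] (z : E) :
    ‖z‖ₑ ^ (2 : ℝ) = ((‖z‖₊ : ℝ≥0∞)) ^ 2 := by
  rw [show (2 : ℝ) = ((2 : ℕ) : ℝ) by norm_num, ENNReal.rpow_natCast, enorm_eq_nnnorm]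

/-- **The components of a core function are square integrable on the torus**, with
`∫_{(ℝ/ℤ)^{3N}} ‖compFun c ∘ fromUnitTorusN‖₊² = L^{-3N} ∫_{[0,L)^{3N}} ‖compFun c‖₊²`. [folklore] -/
theorem lintegral_torusFunN_compFun_sq (hL : 0 < L) (hv : Measurable v) {Ψ : Config N → ℂ}
    (hΨ : ContDiff ℝ 1 Ψ) (c : CompIdx N) :
    ∫⁻ t, ((‖torusFunN L (compFun v L Ψ c) t‖₊ : ℝ≥0∞)) ^ 2 =
      ((ENNReal.ofReal L ^ 3)⁻¹) ^ N * ∫⁻ X in cellN N L, ((‖compFun v L Ψ c X‖₊ : ℝ≥0∞)) ^ 2 :=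
  lintegral_fromUnitTorusN hL (G := fun X => ((‖compFun v L Ψ c X‖₊ : ℝ≥0∞)) ^ 2)
    ((measurable_compFun hv hΨ c).nnnorm.coe_nnreal_ennreal.pow_const 2)

/-- The components of a core function, transported to the torus, are in `L²((ℝ/ℤ)^{3N})`. [folklore] -/
theorem memLp_torusFunN_compFun (hL : 0 < L) (hv : Measurable v)
    (hW : ∫⁻ X in cellN N L, periodicInteraction v L X ≠ ⊤) {Ψ : Config N → ℂ} (hΨ : ContDiff ℝ 1 Ψ)
    (c : CompIdx N) : MemLp (torusFunN L (compFun v L Ψ c)) 2 volume := by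
  refine ⟨((measurable_compFun hv hΨ c).comp (measurable_fromUnitTorusN L)).aestronglyMeasurable, ?_⟩
  rw [eLpNorm_lt_top_iff_lintegral_rpow_enorm_lt_top two_ne_zero ENNReal.ofNat_ne_top]
  simp only [ENNReal.toReal_ofNat, enorm_rpow_two_eq_coe_nnnorm_sq]
  rw [show (fun a => ((‖torusFunN L (compFun v L Ψ c) a‖₊ : ℝ≥0∞)) ^ 2) =
    fun t => ((‖torusFunN L (compFun v L Ψ c) t‖₊ : ℝ≥0∞)) ^ 2 from rfl,
    lintegral_torusFunN_compFun_sq hL hv hΨ c]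
  exact ENNReal.mul_lt_top (ENNReal.pow_lt_top (ENNReal.inv_lt_top.2
    (ENNReal.pow_pos (ENNReal.ofReal_pos.2 hL) 3))) (lintegral_cellN_compFun_sq_lt_top hW hΨ c)

/-! ### The graph embedding, the form domain and the embedding `ι` -/

/-- The scale `L^{3N/2}` (so that the transported `L²` norms are the cell norms). [folklore] -/
def cellScale (N : ℕ) (L : ℝ) : ℝ := Real.sqrt ((L ^ 3) ^ N)

/-- `(L^{3N/2})² = L^{3N}`. [folklore] -/
theorem cellScale_sq (hL : 0 ≤ L) : cellScale N L ^ 2 = (L ^ 3) ^ N :=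
  Real.sq_sqrt (by positivity)

/-- `0 ≤ L^{3N/2}`. [folklore] -/
theorem cellScale_nonneg (N : ℕ) (L : ℝ) : 0 ≤ cellScale N L := Real.sqrt_nonneg _

/-- The `L²((ℝ/ℤ)^{3N})` class `L^{3N/2} [compFun c ∘ fromUnitTorusN L]` of a component of a `C¹`
function. [folklore] -/
def compLp (hL : 0 < L) (hv : Measurable v) (hW : ∫⁻ X in cellN N L, periodicInteraction v L X ≠ ⊤)
    {Ψ : Config N → ℂ} (hΨ : ContDiff ℝ 1 Ψ) (c : CompIdx N) : L2T N :=
  ((cellScale N L : ℝ) : ℂ) • (memLp_torusFunN_compFun hL hv hW hΨ c).toLp (torusFunN L (compFun v L Ψ c))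

/-- `compLp` only depends on the component function. [folklore] -/
theorem compLp_congr (hL : 0 < L) (hv : Measurable v) (hW : ∫⁻ X in cellN N L, periodicInteraction v L X ≠ ⊤)
    {Ψ Φ : Config N → ℂ} (hΨ : ContDiff ℝ 1 Ψ) (hΦ : ContDiff ℝ 1 Φ) {c d : CompIdx N}
    (h : compFun v L Ψ c = compFun v L Φ d) : compLp hL hv hW hΨ c = compLp hL hv hW hΦ d := by
  unfold compLp
  congr 1
  exact MemLp.toLp_congr _ _ (Eventually.of_forall fun t => by simp only [torusFunN, h])

/-- Additivity of `compLp`. [folklore] -/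
theorem compLp_add (hL : 0 < L) (hv : Measurable v) (hW : ∫⁻ X in cellN N L, periodicInteraction v L X ≠ ⊤)
    {Ψ Φ : Config N → ℂ} (hΨ : ContDiff ℝ 1 Ψ) (hΦ : ContDiff ℝ 1 Φ) (c : CompIdx N) :
    compLp hL hv hW (hΨ.add hΦ) c = compLp hL hv hW hΨ c + compLp hL hv hW hΦ c := by
  unfold compLp
  rw [← smul_add, ← MemLp.toLp_add]
  congr 1
  exact MemLp.toLp_congr _ _ (Eventually.of_forall fun t => by
    show compFun v L (Ψ + Φ) c (fromUnitTorusN L t) = _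
    rw [compFun_add hΨ hΦ]
    rfl)

/-- Homogeneity of `compLp`. [folklore] -/
theorem compLp_smul (hL : 0 < L) (hv : Measurable v) (hW : ∫⁻ X in cellN N L, periodicInteraction v L X ≠ ⊤)
    {Ψ : Config N → ℂ} (hΨ : ContDiff ℝ 1 Ψ) (a : ℂ) (haΨ : ContDiff ℝ 1 (a • Ψ)) (c : CompIdx N) :
    compLp hL hv hW haΨ c = a • compLp hL hv hW hΨ c := by
  unfold compLp
  have h1 : (memLp_torusFunN_compFun hL hv hW haΨ c).toLp (torusFunN L (compFun v L (a • Ψ) c)) =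
      ((memLp_torusFunN_compFun hL hv hW hΨ c).const_smul a).toLp (a • torusFunN L (compFun v L Ψ c)) :=
    MemLp.toLp_congr _ _ (Eventually.of_forall fun t => by
      show compFun v L (a • Ψ) c (fromUnitTorusN L t) = _
      rw [compFun_smul hΨ]
      rfl)
  rw [h1, MemLp.toLp_const_smul, smul_comm]

/-- **The graph embedding** `𝒞 → ⨁_c L²((ℝ/ℤ)^{3N})`, `Ψ ↦ L^{3N/2}(Ψ, (∂_{i,k}Ψ), √W Ψ) ∘ fromUnitTorusN L`
(a linear map; the graph of the form `q(Ψ) = ∫|∇Ψ|² + W|Ψ|²` over the core).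
[cite: ReedSimonI1980, §VIII.6] -/
def graphEmbed (hL : 0 < L) (hv : Measurable v) (hW : ∫⁻ X in cellN N L, periodicInteraction v L X ≠ ⊤) :
    periodicCore N L →ₗ[ℂ] PiLp 2 (fun _ : CompIdx N => L2T N) where
  toFun Ψ := WithLp.toLp 2 fun c => compLp hL hv hW Ψ.2.1 c
  map_add' Ψ Φ := by
    ext c : 1
    simp only [PiLp.add_apply]
    exact compLp_add hL hv hW Ψ.2.1 Φ.2.1 c
  map_smul' a Ψ := by
    ext c : 1
    simp only [PiLp.smul_apply, RingHom.id_apply]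
    exact compLp_smul hL hv hW Ψ.2.1 a (a • Ψ).2.1 c

/-- The components of the graph embedding. [folklore] -/
theorem graphEmbed_apply (hL : 0 < L) (hv : Measurable v) (hW : ∫⁻ X in cellN N L, periodicInteraction v L X ≠ ⊤)
    (Ψ : periodicCore N L) (c : CompIdx N) :
    graphEmbed hL hv hW Ψ c = compLp hL hv hW Ψ.2.1 c := rfl

/-- **The form domain** `Q`: the closure of the graph of the form over the core, a closed subspace
of the Hilbert space `⨁_c L²((ℝ/ℤ)^{3N})` (hence a Hilbert space). [cite: ReedSimonI1980, §VIII.6] -/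
def formDomain (hL : 0 < L) (hv : Measurable v) (hW : ∫⁻ X in cellN N L, periodicInteraction v L X ≠ ⊤) :
    Submodule ℂ (PiLp 2 (fun _ : CompIdx N => L2T N)) :=
  (LinearMap.range (graphEmbed hL hv hW)).topologicalClosure

/-- **The embedding `ι : Q → L²((ℝ/ℤ)^{3N})`** of the form domain (the value component).
[cite: ReedSimonIV1978, Thm. XIII.64] -/
def formEmbed (hL : 0 < L) (hv : Measurable v) (hW : ∫⁻ X in cellN N L, periodicInteraction v L X ≠ ⊤) :
    formDomain hL hv hW →L[ℂ] L2T N :=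
  (PiLp.proj 2 (fun _ : CompIdx N => L2T N) (Sum.inl ())) ∘L (formDomain hL hv hW).subtypeL

/-- `ι ξ` is the value component of `ξ`. [folklore] -/
theorem formEmbed_apply (hL : 0 < L) (hv : Measurable v) (hW : ∫⁻ X in cellN N L, periodicInteraction v L X ≠ ⊤)
    (ξ : formDomain hL hv hW) : formEmbed hL hv hW ξ = (ξ : PiLp 2 (fun _ : CompIdx N => L2T N)) (Sum.inl ()) := rfl

/-- The graph of a core function lies in the form domain. [folklore] -/
theorem graphEmbed_mem_formDomain (hL : 0 < L) (hv : Measurable v)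
    (hW : ∫⁻ X in cellN N L, periodicInteraction v L X ≠ ⊤) (Ψ : periodicCore N L) :
    graphEmbed hL hv hW Ψ ∈ formDomain hL hv hW :=
  Submodule.le_topologicalClosure _ (LinearMap.mem_range_self _ Ψ)

/-- The core, as a subspace of the form domain (the range of the graph embedding). [folklore] -/
def coreRange (hL : 0 < L) (hv : Measurable v) (hW : ∫⁻ X in cellN N L, periodicInteraction v L X ≠ ⊤) :
    Submodule ℂ (formDomain hL hv hW) :=
  Submodule.comap (formDomain hL hv hW).subtype (LinearMap.range (graphEmbed hL hv hW))

/-- **The core is dense in the form domain** (a form core, by construction). [cite: ReedSimonI1980, §VIII.6] -/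
theorem dense_coreRange (hL : 0 < L) (hv : Measurable v) (hW : ∫⁻ X in cellN N L, periodicInteraction v L X ≠ ⊤) :
    Dense (coreRange hL hv hW : Set (formDomain hL hv hW)) := by
  rw [Subtype.dense_iff]
  intro x hx
  have hx' : x ∈ closure (LinearMap.range (graphEmbed hL hv hW) : Set (PiLp 2 (fun _ : CompIdx N => L2T N))) := by
    rw [← Submodule.topologicalClosure_coe]; exact hx
  refine closure_mono ?_ hx'
  rintro y ⟨Ψ, rfl⟩
  exact ⟨⟨graphEmbed hL hv hW Ψ, graphEmbed_mem_formDomain hL hv hW Ψ⟩, ⟨Ψ, rfl⟩, rfl⟩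

/-! ### The dictionary: norms and inner products are cell integrals -/

/-- `‖toLp f‖² = ∫ ‖f‖₊²` (as a real number) for `f ∈ L²`. [folklore] -/
theorem norm_toLp_sq_eq_toReal_lintegral {α : Type*} [MeasurableSpace α] {μ : Measure α} {f : α → ℂ} (hf : MemLp f 2 μ) :
    ‖hf.toLp f‖ ^ 2 = (∫⁻ x, ((‖f x‖₊ : ℝ≥0∞)) ^ 2 ∂μ).toReal := by
  rw [Lp.norm_toLp, eLpNorm_eq_lintegral_rpow_enorm_toReal two_ne_zero ENNReal.ofNat_ne_top,
    ENNReal.toReal_ofNat]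
  simp only [enorm_rpow_two_eq_coe_nnnorm_sq, one_div]
  rw [← ENNReal.toReal_rpow, ← Real.rpow_natCast, ← Real.rpow_mul ENNReal.toReal_nonneg]
  norm_num

/-- **Component norms are cell integrals**: `‖(graphEmbed Ψ)_c‖² = ∫_{[0,L)^{3N}} ‖compFun c‖₊²`.
[folklore] -/
theorem norm_compLp_sq (hL : 0 < L) (hv : Measurable v) (hW : ∫⁻ X in cellN N L, periodicInteraction v L X ≠ ⊤)
    {Ψ : Config N → ℂ} (hΨ : ContDiff ℝ 1 Ψ) (c : CompIdx N) :
    ‖compLp hL hv hW hΨ c‖ ^ 2 = (∫⁻ X in cellN N L, ((‖compFun v L Ψ c X‖₊ : ℝ≥0∞)) ^ 2).toReal := by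
  rw [compLp, norm_smul, mul_pow, Complex.norm_real, Real.norm_of_nonneg (cellScale_nonneg N L),
    cellScale_sq hL.le, norm_toLp_sq_eq_toReal_lintegral, lintegral_torusFunN_compFun_sq hL hv hΨ, ENNReal.toReal_mul,
    ← mul_assoc, ENNReal.toReal_pow, ENNReal.toReal_inv, ENNReal.toReal_pow, ENNReal.toReal_ofReal hL.le,
    ← mul_pow, mul_inv_cancel₀ (pow_ne_zero 3 hL.ne'), one_pow, one_mul]

/-- `W < ∞` a.e. on the cell when `W ∈ L¹` of the cell. [folklore] -/
theorem ae_periodicInteraction_lt_top (hv : Measurable v) (hW : ∫⁻ X in cellN N L, periodicInteraction v L X ≠ ⊤) :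
    ∀ᵐ X ∂(volume.restrict (cellN N L)), periodicInteraction v L X < ⊤ :=
  ae_lt_top (measurable_periodicInteraction' hv L) hW

/-- The potential component: `∫_{[0,L)^{3N}} ‖√W Ψ‖₊² = ∫_{[0,L)^{3N}} W‖Ψ‖₊²` (`W < ∞` a.e.). [folklore] -/
theorem lintegral_cellN_sqrt_mul_sq (hv : Measurable v) (hW : ∫⁻ X in cellN N L, periodicInteraction v L X ≠ ⊤)
    (Ψ : Config N → ℂ) :
    ∫⁻ X in cellN N L, ((‖((Real.sqrt (periodicInteraction v L X).toReal : ℝ) : ℂ) * Ψ X‖₊ : ℝ≥0∞)) ^ 2 =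
      ∫⁻ X in cellN N L, periodicInteraction v L X * ((‖Ψ X‖₊ : ℝ≥0∞)) ^ 2 :=
  lintegral_congr_ae ((ae_periodicInteraction_lt_top hv hW).mono fun _ hX => nnnorm_sqrt_mul_sq_eq hX.ne _)

/-- **The norm of the graph embedding is the energy plus the `L²` norm**:
`‖graphEmbed Ψ‖² = ∫_{[0,L)^{3N}} ‖Ψ‖₊² + ∫_{[0,L)^{3N}} (|∇Ψ|² + W‖Ψ‖₊²)` (both integrals finite).
[cite: ReedSimonI1980, §VIII.6] -/
theorem norm_graphEmbed_sq (hL : 0 < L) (hv : Measurable v) (hW : ∫⁻ X in cellN N L, periodicInteraction v L X ≠ ⊤)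
    (Ψ : periodicCore N L) :
    ‖graphEmbed hL hv hW Ψ‖ ^ 2 =
      (∫⁻ X in cellN N L, ((‖(Ψ : Config N → ℂ) X‖₊ : ℝ≥0∞)) ^ 2).toReal +
      (∫⁻ X in cellN N L, kineticDensity (Ψ : Config N → ℂ) X +
        periodicInteraction v L X * ((‖(Ψ : Config N → ℂ) X‖₊ : ℝ≥0∞)) ^ 2).toReal := by
  have hΨ : ContDiff ℝ 1 (Ψ : Config N → ℂ) := Ψ.2.1
  rw [PiLp.norm_sq_eq_of_L2]
  simp only [graphEmbed_apply, norm_compLp_sq hL hv hW hΨ]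
  rw [Fintype.sum_sum_type, Fintype.sum_sum_type]
  simp only [Finset.univ_unique, Finset.sum_singleton, compFun_val, compFun_grad, compFun_pot]
  rw [lintegral_cellN_sqrt_mul_sq hv hW]
  congr 1
  -- the kinetic and potential parts
  have hkin_meas : ∀ p : Fin N × Fin 3, Measurable fun X : Config N =>
      ((‖fderiv ℝ (Ψ : Config N → ℂ) X (Pi.single p.1 (EuclideanSpace.single p.2 1))‖₊ : ℝ≥0∞)) ^ 2 :=
    fun p => (continuous_fderiv_config_single hΨ p.1 p.2).measurable.nnnorm.coe_nnreal_ennreal.pow_const 2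
  have hkin : ∀ X, kineticDensity (Ψ : Config N → ℂ) X = ∑ p : Fin N × Fin 3,
      ((‖fderiv ℝ (Ψ : Config N → ℂ) X (Pi.single p.1 (EuclideanSpace.single p.2 1))‖₊ : ℝ≥0∞)) ^ 2 :=
    fun X => by rw [kineticDensity, Fintype.sum_prod_type]
  have hfin : ∀ p : Fin N × Fin 3, ∫⁻ X in cellN N L,
      ((‖fderiv ℝ (Ψ : Config N → ℂ) X (Pi.single p.1 (EuclideanSpace.single p.2 1))‖₊ : ℝ≥0∞)) ^ 2 ≠ ⊤ :=
    fun p => (lintegral_cellN_sq_lt_top L (continuous_fderiv_config_single hΨ p.1 p.2)).ne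
  rw [← ENNReal.toReal_sum (fun p _ => hfin p),
    ← ENNReal.toReal_add (ENNReal.sum_ne_top.2 fun p _ => hfin p)
      (lintegral_cellN_pot_sq_lt_top hW hΨ.continuous).ne]
  congr 1
  have hpm : Measurable fun X : Config N =>
      periodicInteraction v L X * ((‖(Ψ : Config N → ℂ) X‖₊ : ℝ≥0∞)) ^ 2 :=
    (measurable_periodicInteraction' hv L).mul (hΨ.continuous.measurable.nnnorm.coe_nnreal_ennreal.pow_const 2)
  rw [lintegral_add_right _ hpm]
  congr 1
  simp_rw [hkin]
  rw [lintegral_finsetSum _ fun p _ => hkin_meas p]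

/-- The raw energy of a core function is finite: `∫ |∇Ψ|² + W‖Ψ‖₊² < ∞`. [folklore] -/
theorem lintegral_energy_lt_top (hv : Measurable v) (hW : ∫⁻ X in cellN N L, periodicInteraction v L X ≠ ⊤)
    {Ψ : Config N → ℂ} (hΨ : ContDiff ℝ 1 Ψ) :
    ∫⁻ X in cellN N L, kineticDensity Ψ X + periodicInteraction v L X * ((‖Ψ X‖₊ : ℝ≥0∞)) ^ 2 < ⊤ := by
  have hpm : Measurable fun X : Config N => periodicInteraction v L X * ((‖Ψ X‖₊ : ℝ≥0∞)) ^ 2 :=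
    (measurable_periodicInteraction' hv L).mul (hΨ.continuous.measurable.nnnorm.coe_nnreal_ennreal.pow_const 2)
  rw [lintegral_add_right _ hpm]
  refine ENNReal.add_lt_top.2 ⟨?_, lintegral_cellN_pot_sq_lt_top hW hΨ.continuous⟩
  have hkin : ∀ X, kineticDensity Ψ X = ∑ p : Fin N × Fin 3,
      ((‖fderiv ℝ Ψ X (Pi.single p.1 (EuclideanSpace.single p.2 1))‖₊ : ℝ≥0∞)) ^ 2 :=
    fun X => by rw [kineticDensity, Fintype.sum_prod_type]
  simp_rw [hkin]
  rw [lintegral_finsetSum _ fun p _ =>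
    (continuous_fderiv_config_single hΨ p.1 p.2).measurable.nnnorm.coe_nnreal_ennreal.pow_const 2]
  exact ENNReal.sum_lt_top.2 fun p _ => lintegral_cellN_sq_lt_top L (continuous_fderiv_config_single hΨ p.1 p.2)

/-- **For a periodic trial state** (normalised on the cell): `‖graphEmbed Ψ‖² = 1 + periodicEnergy v Ψ`.
[folklore] -/
theorem norm_graphEmbed_sq_trialState (hL : 0 < L) (hv : Measurable v)
    (hW : ∫⁻ X in cellN N L, periodicInteraction v L X ≠ ⊤) (Ψ : PeriodicTrialState N L) :
    ‖graphEmbed hL hv hW ⟨Ψ.ψ, Ψ.mem_periodicCore⟩‖ ^ 2 = 1 + (periodicEnergy v Ψ).toReal := by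
  rw [norm_graphEmbed_sq, Ψ.norm_eq, ENNReal.toReal_one]
  rfl

/-- **The embedded norm is the cell norm**: `‖ι(graphEmbed Ψ)‖² = ∫_{[0,L)^{3N}} ‖Ψ‖₊²`. [folklore] -/
theorem norm_formEmbed_graphEmbed_sq (hL : 0 < L) (hv : Measurable v)
    (hW : ∫⁻ X in cellN N L, periodicInteraction v L X ≠ ⊤) (Ψ : periodicCore N L) :
    ‖formEmbed hL hv hW ⟨graphEmbed hL hv hW Ψ, graphEmbed_mem_formDomain hL hv hW Ψ⟩‖ ^ 2 =
      (∫⁻ X in cellN N L, ((‖(Ψ : Config N → ℂ) X‖₊ : ℝ≥0∞)) ^ 2).toReal := by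
  rw [formEmbed_apply]
  exact norm_compLp_sq hL hv hW Ψ.2.1 (Sum.inl ())

/-- For a periodic trial state `‖ι(graphEmbed Ψ)‖ = 1`. [folklore] -/
theorem norm_formEmbed_graphEmbed_trialState (hL : 0 < L) (hv : Measurable v)
    (hW : ∫⁻ X in cellN N L, periodicInteraction v L X ≠ ⊤) (Ψ : PeriodicTrialState N L) :
    ‖formEmbed hL hv hW ⟨graphEmbed hL hv hW ⟨Ψ.ψ, Ψ.mem_periodicCore⟩,
      graphEmbed_mem_formDomain hL hv hW _⟩‖ = 1 := by
  have h := norm_formEmbed_graphEmbed_sq hL hv hW ⟨Ψ.ψ, Ψ.mem_periodicCore⟩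
  rw [show ((⟨Ψ.ψ, Ψ.mem_periodicCore⟩ : periodicCore N L) : Config N → ℂ) = Ψ.ψ from rfl, Ψ.norm_eq,
    ENNReal.toReal_one, pow_eq_one_iff_of_nonneg (norm_nonneg _) two_ne_zero] at h
  exact h

/-- **The embedded inner product is the cell inner product**:
`⟪ι(graphEmbed Ψ), ι(graphEmbed Φ)⟫ = ∫_{[0,L)^{3N}} conj(Ψ) Φ`. [folklore] -/
theorem inner_formEmbed_graphEmbed (hL : 0 < L) (hv : Measurable v)
    (hW : ∫⁻ X in cellN N L, periodicInteraction v L X ≠ ⊤) (Ψ Φ : periodicCore N L) :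
    ⟪formEmbed hL hv hW ⟨graphEmbed hL hv hW Ψ, graphEmbed_mem_formDomain hL hv hW Ψ⟩,
      formEmbed hL hv hW ⟨graphEmbed hL hv hW Φ, graphEmbed_mem_formDomain hL hv hW Φ⟩⟫_ℂ =
      ∫ X in cellN N L, conj ((Ψ : Config N → ℂ) X) * (Φ : Config N → ℂ) X := by
  rw [formEmbed_apply, formEmbed_apply]
  show ⟪compLp hL hv hW Ψ.2.1 (Sum.inl ()), compLp hL hv hW Φ.2.1 (Sum.inl ())⟫_ℂ = _
  rw [compLp, compLp, inner_smul_left, inner_smul_right, Complex.conj_ofReal, ← mul_assoc,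
    ← Complex.ofReal_mul, ← sq, cellScale_sq hL.le, MeasureTheory.L2.inner_def]
  have hae := ((memLp_torusFunN_compFun hL hv hW Ψ.2.1 (Sum.inl ())).coeFn_toLp).and
    ((memLp_torusFunN_compFun hL hv hW Φ.2.1 (Sum.inl ())).coeFn_toLp)
  rw [integral_congr_ae (hae.mono fun t ht => by rw [ht.1, ht.2])]
  simp only [compFun_val, torusFunN, RCLike.inner_apply']
  have hmeas : AEStronglyMeasurable (fun X => conj ((Ψ : Config N → ℂ) X) * (Φ : Config N → ℂ) X)
      (volume.restrict (cellN N L)) :=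
    (Ψ.2.1.continuous.aestronglyMeasurable.star).mul Φ.2.1.continuous.aestronglyMeasurable
  have htr : ∫ t, conj ((Ψ : Config N → ℂ) (fromUnitTorusN L t)) * (Φ : Config N → ℂ) (fromUnitTorusN L t) =
      ((((L ^ 3)⁻¹) ^ N : ℝ)) • ∫ X in cellN N L, conj ((Ψ : Config N → ℂ) X) * (Φ : Config N → ℂ) X :=
    integral_fromUnitTorusN hL (G := fun X => conj ((Ψ : Config N → ℂ) X) * (Φ : Config N → ℂ) X) hmeas
  rw [htr, Complex.real_smul, ← mul_assoc, ← Complex.ofReal_mul, ← mul_pow,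
    mul_inv_cancel₀ (pow_ne_zero 3 hL.ne'), one_pow, Complex.ofReal_one, one_mul]

/-! ### Closability: the embedding `ι` is injective -/

/-- Elements of the form domain are limits of graphs of core functions. [folklore] -/
theorem exists_seq_tendsto_of_mem_formDomain (hL : 0 < L) (hv : Measurable v)
    (hW : ∫⁻ X in cellN N L, periodicInteraction v L X ≠ ⊤) (ξ : formDomain hL hv hW) :
    ∃ Ψ : ℕ → periodicCore N L, Tendsto (fun j => graphEmbed hL hv hW (Ψ j)) atTop
      (𝓝 (ξ : PiLp 2 (fun _ : CompIdx N => L2T N))) := by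
  have hξ : (ξ : PiLp 2 (fun _ : CompIdx N => L2T N)) ∈
      closure (LinearMap.range (graphEmbed hL hv hW) : Set (PiLp 2 (fun _ : CompIdx N => L2T N))) := by
    rw [← Submodule.topologicalClosure_coe]; exact ξ.2
  obtain ⟨x, hx, hlim⟩ := mem_closure_iff_seq_limit.1 hξ
  choose Ψ hΨ using hx
  refine ⟨Ψ, ?_⟩
  have : (fun j => graphEmbed hL hv hW (Ψ j)) = x := funext hΨ
  rw [this]
  exact hlim

/-- The Fourier coefficients of the `L²` class of a transported continuous function are its cell
coefficients: `⟪e_n, [f ∘ fromUnitTorusN]⟫ = ĉₙ(f)`. [folklore] -/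
theorem inner_mFourierLp_toLp (hL : 0 < L) {f : Config N → ℂ} (hf : Continuous f)
    (hmem : MemLp (torusFunN L f) 2 volume) (n : Fin N × Fin 3 → ℤ) :
    ⟪(mFourierLp 2 n : L2T N), hmem.toLp (torusFunN L f)⟫_ℂ = configFourierCoeff L f n := by
  rw [← coe_mFourierBasis, ← HilbertBasis.repr_apply_apply, mFourierBasis_repr]
  exact mFourierCoeff_toLp_torusFunN hL hf n

/-- The Fourier coefficients of the value component: `⟪e_n, (graphEmbed Ψ)_val⟫ = L^{3N/2} ĉₙ(Ψ)`.
[folklore] -/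
theorem inner_mFourierLp_compLp_val (hL : 0 < L) (hv : Measurable v)
    (hW : ∫⁻ X in cellN N L, periodicInteraction v L X ≠ ⊤) {Ψ : Config N → ℂ} (hΨ : ContDiff ℝ 1 Ψ)
    (n : Fin N × Fin 3 → ℤ) :
    ⟪(mFourierLp 2 n : L2T N), compLp hL hv hW hΨ (Sum.inl ())⟫_ℂ =
      (cellScale N L : ℂ) * configFourierCoeff L Ψ n := by
  simp only [compLp, compFun_val, inner_smul_right]
  rw [inner_mFourierLp_toLp hL hΨ.continuous]

/-- The Fourier coefficients of a gradient component are `2πi n_{i,k}/L` times those of the value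
component (`configFourierCoeff_fderiv`). [folklore] -/
theorem inner_mFourierLp_compLp_grad (hL : 0 < L) (hv : Measurable v)
    (hW : ∫⁻ X in cellN N L, periodicInteraction v L X ≠ ⊤) {Ψ : Config N → ℂ} (hΨ : ContDiff ℝ 1 Ψ)
    (hper : IsTorusPeriodic L Ψ) (n : Fin N × Fin 3 → ℤ) (p : Fin N × Fin 3) :
    ⟪(mFourierLp 2 n : L2T N), compLp hL hv hW hΨ (Sum.inr (Sum.inl p))⟫_ℂ =
      (2 * Real.pi * I * (n p) / L) * ⟪(mFourierLp 2 n : L2T N), compLp hL hv hW hΨ (Sum.inl ())⟫_ℂ := by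
  rw [inner_mFourierLp_compLp_val]
  simp only [compLp, compFun_grad, inner_smul_right]
  rw [inner_mFourierLp_toLp hL (continuous_fderiv_config_single hΨ p.1 p.2),
    configFourierCoeff_fderiv hL hΨ hper n p.1 p.2]
  ring

/-- The potential and value components, as functions on the torus: a.e.
`(graphEmbed Ψ)_pot = √W ∘ fromUnitTorusN · (graphEmbed Ψ)_val`. [folklore] -/
theorem coeFn_compLp_pot_ae (hL : 0 < L) (hv : Measurable v)
    (hW : ∫⁻ X in cellN N L, periodicInteraction v L X ≠ ⊤) {Ψ : Config N → ℂ} (hΨ : ContDiff ℝ 1 Ψ) :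
    ∀ᵐ t ∂(volume : Measure (UnitAddTorus (Fin N × Fin 3))),
      (compLp hL hv hW hΨ (Sum.inr (Sum.inr ())) : UnitAddTorus (Fin N × Fin 3) → ℂ) t =
        ((Real.sqrt (periodicInteraction v L (fromUnitTorusN L t)).toReal : ℝ) : ℂ) *
          (compLp hL hv hW hΨ (Sum.inl ()) : UnitAddTorus (Fin N × Fin 3) → ℂ) t := by
  have h1 := (Lp.coeFn_smul ((cellScale N L : ℝ) : ℂ)
    ((memLp_torusFunN_compFun hL hv hW hΨ (Sum.inr (Sum.inr ()))).toLp _)).and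
    (memLp_torusFunN_compFun hL hv hW hΨ (Sum.inr (Sum.inr ()))).coeFn_toLp
  have h2 := (Lp.coeFn_smul ((cellScale N L : ℝ) : ℂ)
    ((memLp_torusFunN_compFun hL hv hW hΨ (Sum.inl ())).toLp _)).and
    (memLp_torusFunN_compFun hL hv hW hΨ (Sum.inl ())).coeFn_toLp
  filter_upwards [h1, h2] with t ht1 ht2
  unfold compLp
  rw [ht1.1, ht2.1, Pi.smul_apply, Pi.smul_apply, ht1.2, ht2.2]
  simp only [torusFunN, compFun_pot, compFun_val, smul_eq_mul]
  ring

/-- **Closability of the form: the embedding `ι` is injective.** If `graphEmbed Ψⱼ → ξ` in the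
graph space and the value components tend to `0`, then all components of `ξ` vanish: the gradient
components because their Fourier coefficients are `2πi n_{i,k}/L` times those of the value
components, the potential component because it is `√W` times the value component along an
a.e.-convergent subsequence. [cite: ReedSimonI1980, §VIII.6 (the form of a non-negative operator is closable)] -/
theorem formEmbed_injective (hL : 0 < L) (hv : Measurable v)
    (hW : ∫⁻ X in cellN N L, periodicInteraction v L X ≠ ⊤) :
    Function.Injective (formEmbed hL hv hW) := by
  refine (injective_iff_map_eq_zero _).2 fun ξ hξ => ?_
  obtain ⟨Ψ, hΨ⟩ := exists_seq_tendsto_of_mem_formDomain hL hv hW ξ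
  have hc : ∀ c : CompIdx N, Tendsto (fun j => graphEmbed hL hv hW (Ψ j) c) atTop
      (𝓝 ((ξ : PiLp 2 (fun _ : CompIdx N => L2T N)) c)) := fun c =>
    ((PiLp.proj (𝕜 := ℂ) 2 (fun _ : CompIdx N => L2T N) c).continuous.tendsto _).comp hΨ
  have h0 : (ξ : PiLp 2 (fun _ : CompIdx N => L2T N)) (Sum.inl ()) = 0 := hξ
  have hval : Tendsto (fun j => graphEmbed hL hv hW (Ψ j) (Sum.inl ())) atTop (𝓝 0) := by
    rw [← h0]; exact hc _
  apply Subtype.ext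
  ext c : 1
  rw [Submodule.coe_zero, PiLp.zero_apply]
  rcases c with u | p | u
  · cases u; exact h0
  · -- gradient components: all Fourier coefficients vanish
    set G := (ξ : PiLp 2 (fun _ : CompIdx N => L2T N)) (Sum.inr (Sum.inl p)) with hG
    have hcoef : ∀ n, ⟪(mFourierLp 2 n : L2T N), G⟫_ℂ = 0 := fun n => by
      have hcont : Continuous fun g : L2T N => ⟪(mFourierLp 2 n : L2T N), g⟫_ℂ :=
        continuous_const.inner continuous_id
      have h1 := (hcont.tendsto G).comp (hc (Sum.inr (Sum.inl p)))
      have h2 := (hcont.tendsto (0 : L2T N)).comp hval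
      rw [inner_zero_right] at h2
      have h3 : (fun g : L2T N => ⟪(mFourierLp 2 n : L2T N), g⟫_ℂ) ∘
          (fun j => graphEmbed hL hv hW (Ψ j) (Sum.inr (Sum.inl p))) =
          fun j => (2 * Real.pi * I * (n p) / L) *
            ((fun g : L2T N => ⟪(mFourierLp 2 n : L2T N), g⟫_ℂ) ∘
              (fun j => graphEmbed hL hv hW (Ψ j) (Sum.inl ()))) j := by
        funext j
        simp only [Function.comp_apply, graphEmbed_apply]
        exact inner_mFourierLp_compLp_grad hL hv hW (Ψ j).2.1 (Ψ j).2.2.1 n p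
      rw [h3] at h1
      have h4 := h2.const_mul (2 * Real.pi * I * (n p) / L)
      rw [mul_zero] at h4
      exact tendsto_nhds_unique h1 h4
    have hrepr : (mFourierBasis (d := Fin N × Fin 3)).repr G = 0 := by
      ext n
      rw [HilbertBasis.repr_apply_apply, coe_mFourierBasis, hcoef n]
      rfl
    exact (LinearIsometryEquiv.map_eq_zero_iff _).1 hrepr
  · -- the potential component: `√W` times the value component along a.e. subsequences
    cases u
    set M := (ξ : PiLp 2 (fun _ : CompIdx N => L2T N)) (Sum.inr (Sum.inr ())) with hM
    -- an a.e.-convergent subsequence of the value components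
    obtain ⟨ns, hns, hae1⟩ := (tendstoInMeasure_of_tendsto_Lp hval).exists_seq_tendsto_ae
    have hpot : Tendsto (fun j => graphEmbed hL hv hW (Ψ (ns j)) (Sum.inr (Sum.inr ()))) atTop (𝓝 M) :=
      (hc (Sum.inr (Sum.inr ()))).comp hns.tendsto_atTop
    obtain ⟨ns', hns', hae2⟩ := (tendstoInMeasure_of_tendsto_Lp hpot).exists_seq_tendsto_ae
    -- the pointwise relation between the two components
    have hrel : ∀ᵐ t ∂(volume : Measure (UnitAddTorus (Fin N × Fin 3))), ∀ j,
        (graphEmbed hL hv hW (Ψ j) (Sum.inr (Sum.inr ())) : UnitAddTorus (Fin N × Fin 3) → ℂ) t =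
          ((Real.sqrt (periodicInteraction v L (fromUnitTorusN L t)).toReal : ℝ) : ℂ) *
            (graphEmbed hL hv hW (Ψ j) (Sum.inl ()) : UnitAddTorus (Fin N × Fin 3) → ℂ) t := by
      rw [ae_all_iff]
      intro j
      exact coeFn_compLp_pot_ae hL hv hW (Ψ j).2.1
    have hzero := Lp.coeFn_zero (E := ℂ) (p := 2) (μ := (volume : Measure (UnitAddTorus (Fin N × Fin 3))))
    have hMae : (M : UnitAddTorus (Fin N × Fin 3) → ℂ) =ᵐ[volume] 0 := by
      filter_upwards [hae1, hae2, hrel, hzero] with t ht1 ht2 ht3 ht4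
      -- along `ns ∘ ns'`: value → 0, potential → M t, potential = √W · value
      have hv' : Tendsto (fun j => (graphEmbed hL hv hW (Ψ (ns (ns' j))) (Sum.inl ()) :
          UnitAddTorus (Fin N × Fin 3) → ℂ) t) atTop (𝓝 0) := by
        have := ht1.comp hns'.tendsto_atTop
        rw [ht4] at this
        exact this
      have hp' : Tendsto (fun j => (graphEmbed hL hv hW (Ψ (ns (ns' j))) (Sum.inr (Sum.inr ())) :
          UnitAddTorus (Fin N × Fin 3) → ℂ) t) atTop (𝓝 (M t)) := ht2
      have hp'' : Tendsto (fun j => (graphEmbed hL hv hW (Ψ (ns (ns' j))) (Sum.inr (Sum.inr ())) :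
          UnitAddTorus (Fin N × Fin 3) → ℂ) t) atTop (𝓝 0) := by
        have := hv'.const_mul ((Real.sqrt (periodicInteraction v L (fromUnitTorusN L t)).toReal : ℝ) : ℂ)
        rw [mul_zero] at this
        refine this.congr fun j => ?_
        exact (ht3 (ns (ns' j))).symm
      exact tendsto_nhds_unique hp' hp''
    exact Lp.eq_zero_iff_ae_eq_zero.2 hMae

/-! ### Rellich: the embedding `ι` is a compact operator -/

/-- **Bessel/Parseval for a truncated expansion**: `‖f - ∑_{n ∈ F} ⟪e_n, f⟫ e_n‖² = ∑_{m ∉ F} ‖⟪e_m, f⟫‖²`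
for a Hilbert basis `e`. [folklore] -/
theorem hasSum_norm_sub_sum_inner_smul_sq {ι E : Type*} [DecidableEq ι] [NormedAddCommGroup E]
    [InnerProductSpace ℂ E] (b : HilbertBasis ι ℂ E) (F : Finset ι) (f : E) :
    HasSum (fun m => if m ∈ F then (0 : ℝ) else ‖⟪b m, f⟫_ℂ‖ ^ 2) (‖f - ∑ n ∈ F, ⟪b n, f⟫_ℂ • b n‖ ^ 2) := by
  set g := f - ∑ n ∈ F, ⟪b n, f⟫_ℂ • b n with hg
  have hrepr : ∀ m, b.repr g m = if m ∈ F then 0 else ⟪b m, f⟫_ℂ := fun m => by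
    rw [HilbertBasis.repr_apply_apply, hg, inner_sub_right, inner_sum]
    simp_rw [inner_smul_right, orthonormal_iff_ite.1 b.orthonormal, mul_ite, mul_one, mul_zero,
      Finset.sum_ite_eq]
    split_ifs <;> simp
  have hsum := lp.hasSum_norm (by norm_num : 0 < (2 : ℝ≥0∞).toReal) (b.repr g)
  simp only [ENNReal.toReal_ofNat, Real.rpow_two, hrepr, LinearIsometryEquiv.norm_map] at hsum
  have heq : (fun m => if m ∈ F then (0 : ℝ) else ‖⟪b m, f⟫_ℂ‖ ^ 2) =
      fun i => ‖(if i ∈ F then (0 : ℂ) else ⟪b i, f⟫_ℂ)‖ ^ 2 := by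
    funext m; split_ifs <;> simp
  rw [heq]
  exact hsum

/-- `‖f - ∑_{n ∈ F} ⟪e_n, f⟫ e_n‖² = ∑_{m ∉ F} ‖⟪e_m, f⟫‖²` for a Hilbert basis `e`. [folklore] -/
theorem norm_sub_sum_inner_smul_sq {ι E : Type*} [DecidableEq ι] [NormedAddCommGroup E]
    [InnerProductSpace ℂ E] (b : HilbertBasis ι ℂ E) (F : Finset ι) (f : E) :
    ‖f - ∑ n ∈ F, ⟪b n, f⟫_ℂ • b n‖ ^ 2 = ∑' m, if m ∈ F then (0 : ℝ) else ‖⟪b m, f⟫_ℂ‖ ^ 2 :=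
  (hasSum_norm_sub_sum_inner_smul_sq b F f).tsum_eq.symm

/-- The low-frequency box `F_R = {n ∈ ℤ^{3N} : |n_{i,k}| ≤ R}` (a finite set of momenta). [folklore] -/
def lowFreq (N R : ℕ) : Finset (Fin N × Fin 3 → ℤ) :=
  Fintype.piFinset fun _ => Finset.Icc (-(R : ℤ)) R

/-- Off the low-frequency box some coordinate exceeds `R`, so `|n|² ≥ (R+1)²`. [folklore] -/
theorem sq_le_sum_sq_of_not_mem_lowFreq {R : ℕ} {n : Fin N × Fin 3 → ℤ} (hn : n ∉ lowFreq N R) :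
    ((R : ℝ) + 1) ^ 2 ≤ ∑ p, ((n p : ℝ)) ^ 2 := by
  simp only [lowFreq, Fintype.mem_piFinset, Finset.mem_Icc, not_forall, not_and_or, not_le] at hn
  obtain ⟨p, hp⟩ := hn
  have hp' : (R : ℤ) + 1 ≤ |n p| := by
    rcases hp with h | h
    · rw [abs_of_neg (by omega)]; omega
    · rw [abs_of_pos (by omega)]; omega
  have h1 : ((R : ℝ) + 1) ^ 2 ≤ ((n p : ℝ)) ^ 2 := by
    have : ((R : ℝ) + 1) ≤ |((n p : ℝ))| := by exact_mod_cast hp'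
    calc ((R : ℝ) + 1) ^ 2 ≤ |((n p : ℝ))| ^ 2 := pow_le_pow_left₀ (by positivity) this 2
      _ = ((n p : ℝ)) ^ 2 := sq_abs _
  exact h1.trans (Finset.single_le_sum (f := fun p => ((n p : ℝ)) ^ 2) (fun p _ => sq_nonneg _)
    (Finset.mem_univ p))

/-- **The Fourier truncations of the embedding**: `T_R ξ = ∑_{n ∈ F_R} ⟪e_n, ι ξ⟫ e_n`, finite-rank
continuous linear maps `Q → L²((ℝ/ℤ)^{3N})`. [folklore] -/
def truncEmbed (hL : 0 < L) (hv : Measurable v) (hW : ∫⁻ X in cellN N L, periodicInteraction v L X ≠ ⊤)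
    (R : ℕ) : formDomain hL hv hW →L[ℂ] L2T N :=
  ∑ n ∈ lowFreq N R, (ContinuousLinearMap.toSpanSingleton ℂ (mFourierLp 2 n : L2T N)) ∘L
    ((innerSL ℂ (mFourierLp 2 n : L2T N)) ∘L formEmbed hL hv hW)

/-- `T_R ξ = ∑_{n ∈ F_R} ⟪e_n, ι ξ⟫ e_n`. [folklore] -/
theorem truncEmbed_apply (hL : 0 < L) (hv : Measurable v) (hW : ∫⁻ X in cellN N L, periodicInteraction v L X ≠ ⊤)
    (R : ℕ) (ξ : formDomain hL hv hW) :
    truncEmbed hL hv hW R ξ =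
      ∑ n ∈ lowFreq N R, ⟪(mFourierLp 2 n : L2T N), formEmbed hL hv hW ξ⟫_ℂ • (mFourierLp 2 n : L2T N) := by
  unfold truncEmbed
  refine (_root_.sum_apply ..).trans (Finset.sum_congr rfl fun n _ => ?_)
  simp only [ContinuousLinearMap.comp_apply, innerSL_apply_apply, ContinuousLinearMap.toSpanSingleton_apply]

/-- The truncations are compact operators (finite rank). [folklore] -/
theorem isCompactOperator_truncEmbed (hL : 0 < L) (hv : Measurable v)
    (hW : ∫⁻ X in cellN N L, periodicInteraction v L X ≠ ⊤) (R : ℕ) :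
    IsCompactOperator (truncEmbed hL hv hW R) := by
  unfold truncEmbed
  refine Finset.induction_on (motive := fun F : Finset (Fin N × Fin 3 → ℤ) => IsCompactOperator
    (⇑(∑ n ∈ F, (ContinuousLinearMap.toSpanSingleton ℂ (mFourierLp 2 n : L2T N)) ∘L
      ((innerSL ℂ (mFourierLp 2 n : L2T N)) ∘L formEmbed hL hv hW)))) (lowFreq N R) ?_ ?_
  · simp only [Finset.sum_empty]
    exact isCompactOperator_zero
  · intro a F ha ih
    rw [Finset.sum_insert ha]
    refine IsCompactOperator.add ?_ ih
    exact (isCompactOperator_of_locallyCompactSpace_dom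
      ((innerSL ℂ (mFourierLp 2 a : L2T N)) ∘L formEmbed hL hv hW)).clm_comp
        (ContinuousLinearMap.toSpanSingleton ℂ (mFourierLp 2 a : L2T N))

/-- **The tail estimate** (the quantitative Rellich bound on the core): for a core function,
`‖ι(graphEmbed Ψ) - T_R ι(graphEmbed Ψ)‖ ≤ (L/(2π(R+1))) ‖graphEmbed Ψ‖`, because the squared
left-hand side is `L^{3N} ∑_{n ∉ F_R} |ĉₙ(Ψ)|² ≤ L^{3N}(L/(2π(R+1)))² ∑ₙ (4π²|n|²/L²)|ĉₙ(Ψ)|²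
= (L/(2π(R+1)))² ∫ |∇Ψ|²`. [cite: ReedSimonIV1978, Thm. XIII.73–74 (periodic `-Δ` has compact resolvent)] -/
theorem norm_formEmbed_sub_truncEmbed_le_core (hL : 0 < L) (hv : Measurable v)
    (hW : ∫⁻ X in cellN N L, periodicInteraction v L X ≠ ⊤) (R : ℕ) (Ψ : periodicCore N L) :
    ‖formEmbed hL hv hW ⟨graphEmbed hL hv hW Ψ, graphEmbed_mem_formDomain hL hv hW Ψ⟩ -
        truncEmbed hL hv hW R ⟨graphEmbed hL hv hW Ψ, graphEmbed_mem_formDomain hL hv hW Ψ⟩‖ ≤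
      L / (2 * Real.pi * (R + 1)) * ‖graphEmbed hL hv hW Ψ‖ := by
  have hΨ : ContDiff ℝ 1 (Ψ : Config N → ℂ) := Ψ.2.1
  have hper : IsTorusPeriodic L (Ψ : Config N → ℂ) := Ψ.2.2.1
  set f : L2T N := formEmbed hL hv hW ⟨graphEmbed hL hv hW Ψ, graphEmbed_mem_formDomain hL hv hW Ψ⟩ with hf
  have hfval : f = compLp hL hv hW hΨ (Sum.inl ()) := rfl
  set c : ℝ := L / (2 * Real.pi * (R + 1)) with hc
  have hc0 : 0 ≤ c := by positivity
  -- Step 1: the squared distance is the tail sum of the Fourier coefficients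
  have hsq : ‖f - truncEmbed hL hv hW R ⟨graphEmbed hL hv hW Ψ, graphEmbed_mem_formDomain hL hv hW Ψ⟩‖ ^ 2 =
      ∑' m, if m ∈ lowFreq N R then (0 : ℝ) else ‖⟪(mFourierLp 2 m : L2T N), f⟫_ℂ‖ ^ 2 := by
    rw [truncEmbed_apply, ← hf]
    have := norm_sub_sum_inner_smul_sq (mFourierBasis (d := Fin N × Fin 3)) (lowFreq N R) f
    rw [coe_mFourierBasis] at this
    exact this
  -- Step 2: pass to `ℝ≥0∞` and bound each tail term by the weighted term
  have hcoef : ∀ m, ‖⟪(mFourierLp 2 m : L2T N), f⟫_ℂ‖ ^ 2 =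
      cellScale N L ^ 2 * ‖configFourierCoeff L (Ψ : Config N → ℂ) m‖ ^ 2 := fun m => by
    rw [hfval, inner_mFourierLp_compLp_val, norm_mul, mul_pow, Complex.norm_real,
      Real.norm_of_nonneg (cellScale_nonneg N L)]
  have hterm : ∀ m, ENNReal.ofReal (if m ∈ lowFreq N R then (0 : ℝ) else ‖⟪(mFourierLp 2 m : L2T N), f⟫_ℂ‖ ^ 2) ≤
      ENNReal.ofReal (cellScale N L ^ 2 * c ^ 2) *
        (ENNReal.ofReal (∑ p, (2 * Real.pi * (m p) / L) ^ 2) *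
          ((‖configFourierCoeff L (Ψ : Config N → ℂ) m‖₊ : ℝ≥0∞)) ^ 2) := fun m => by
    split_ifs with hm
    · simp
    · rw [hcoef, coe_nnnorm_sq_eq_ofReal, ← ENNReal.ofReal_mul (by positivity),
        ← ENNReal.ofReal_mul (by positivity)]
      refine ENNReal.ofReal_le_ofReal ?_
      have hlow := sq_le_sum_sq_of_not_mem_lowFreq hm
      have hsum : ∑ p, (2 * Real.pi * (m p) / L) ^ 2 = (2 * Real.pi / L) ^ 2 * ∑ p, ((m p : ℝ)) ^ 2 := by
        rw [Finset.mul_sum]; refine Finset.sum_congr rfl fun p _ => by ring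
      rw [hsum]
      have h1 : 1 ≤ c ^ 2 * ((2 * Real.pi / L) ^ 2 * ∑ p, ((m p : ℝ)) ^ 2) := by
        have : c ^ 2 * ((2 * Real.pi / L) ^ 2 * ((R : ℝ) + 1) ^ 2) = 1 := by
          rw [hc]; field_simp
        rw [← this]
        gcongr
      calc cellScale N L ^ 2 * ‖configFourierCoeff L (Ψ : Config N → ℂ) m‖ ^ 2
          = cellScale N L ^ 2 * ‖configFourierCoeff L (Ψ : Config N → ℂ) m‖ ^ 2 * 1 := by ring
        _ ≤ cellScale N L ^ 2 * ‖configFourierCoeff L (Ψ : Config N → ℂ) m‖ ^ 2 *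
            (c ^ 2 * ((2 * Real.pi / L) ^ 2 * ∑ p, ((m p : ℝ)) ^ 2)) := by gcongr
        _ = cellScale N L ^ 2 * c ^ 2 * ((2 * Real.pi / L) ^ 2 * (∑ p, ((m p : ℝ)) ^ 2) *
            ‖configFourierCoeff L (Ψ : Config N → ℂ) m‖ ^ 2) := by ring
  -- Step 3: sum, and use the spectral kinetic energy
  have hsummable : Summable fun m => if m ∈ lowFreq N R then (0 : ℝ) else ‖⟪(mFourierLp 2 m : L2T N), f⟫_ℂ‖ ^ 2 := by
    have := (hasSum_norm_sub_sum_inner_smul_sq (mFourierBasis (d := Fin N × Fin 3)) (lowFreq N R) f).summable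
    rw [coe_mFourierBasis] at this
    exact this
  have hE : ENNReal.ofReal (‖f - truncEmbed hL hv hW R ⟨graphEmbed hL hv hW Ψ, graphEmbed_mem_formDomain hL hv hW Ψ⟩‖ ^ 2)
      ≤ ENNReal.ofReal (c ^ 2 * ‖graphEmbed hL hv hW Ψ‖ ^ 2) := by
    rw [hsq, ENNReal.ofReal_tsum_of_nonneg (fun m => by positivity) hsummable]
    calc ∑' m, ENNReal.ofReal (if m ∈ lowFreq N R then (0 : ℝ) else ‖⟪(mFourierLp 2 m : L2T N), f⟫_ℂ‖ ^ 2)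
        ≤ ∑' m, ENNReal.ofReal (cellScale N L ^ 2 * c ^ 2) *
          (ENNReal.ofReal (∑ p, (2 * Real.pi * (m p) / L) ^ 2) *
            ((‖configFourierCoeff L (Ψ : Config N → ℂ) m‖₊ : ℝ≥0∞)) ^ 2) := ENNReal.tsum_le_tsum hterm
      _ = ENNReal.ofReal (cellScale N L ^ 2 * c ^ 2) *
          (((ENNReal.ofReal L ^ 3)⁻¹) ^ N * ∫⁻ X in cellN N L, kineticDensity (Ψ : Config N → ℂ) X) := by
          rw [ENNReal.tsum_mul_left, tsum_sq_mul_sq_configFourierCoeff hL hΨ hper]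
      _ = ENNReal.ofReal (c ^ 2) * ∫⁻ X in cellN N L, kineticDensity (Ψ : Config N → ℂ) X := by
          rw [mul_comm (cellScale N L ^ 2), ENNReal.ofReal_mul (by positivity), mul_assoc,
            ← mul_assoc (ENNReal.ofReal (cellScale N L ^ 2)), cellScale_sq hL.le,
            ← ofReal_inv_pow_three_pow hL, ← ENNReal.ofReal_mul (by positivity), ← mul_pow,
            mul_inv_cancel₀ (pow_ne_zero 3 hL.ne'), one_pow, ENNReal.ofReal_one, one_mul]
      _ ≤ ENNReal.ofReal (c ^ 2) * ENNReal.ofReal (‖graphEmbed hL hv hW Ψ‖ ^ 2) := by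
          gcongr
          rw [norm_graphEmbed_sq, ENNReal.ofReal_add ENNReal.toReal_nonneg ENNReal.toReal_nonneg,
            ENNReal.ofReal_toReal (lintegral_energy_lt_top hv hW hΨ).ne]
          calc ∫⁻ X in cellN N L, kineticDensity (Ψ : Config N → ℂ) X
              ≤ ∫⁻ X in cellN N L, kineticDensity (Ψ : Config N → ℂ) X +
                  periodicInteraction v L X * ((‖(Ψ : Config N → ℂ) X‖₊ : ℝ≥0∞)) ^ 2 :=
                lintegral_mono fun X => le_self_add
            _ ≤ _ := le_add_self
      _ = ENNReal.ofReal (c ^ 2 * ‖graphEmbed hL hv hW Ψ‖ ^ 2) := by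
          rw [← ENNReal.ofReal_mul (by positivity)]
  -- Step 4: back to real numbers
  have hreal : ‖f - truncEmbed hL hv hW R ⟨graphEmbed hL hv hW Ψ, graphEmbed_mem_formDomain hL hv hW Ψ⟩‖ ^ 2 ≤
      (c * ‖graphEmbed hL hv hW Ψ‖) ^ 2 := by
    rw [mul_pow]
    exact (ENNReal.ofReal_le_ofReal_iff (by positivity)).1 hE
  exact (pow_le_pow_iff_left₀ (norm_nonneg _) (by positivity) two_ne_zero).1 hreal

/-- **The Rellich bound on the form domain**: `‖ι ξ - T_R ι ξ‖ ≤ (L/(2π(R+1))) ‖ξ‖_Q` for every `ξ ∈ Q`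
(from the core by density and continuity). [cite: ReedSimonIV1978, Thm. XIII.64] -/
theorem norm_formEmbed_sub_truncEmbed_le (hL : 0 < L) (hv : Measurable v)
    (hW : ∫⁻ X in cellN N L, periodicInteraction v L X ≠ ⊤) (R : ℕ) (ξ : formDomain hL hv hW) :
    ‖formEmbed hL hv hW ξ - truncEmbed hL hv hW R ξ‖ ≤ L / (2 * Real.pi * (R + 1)) * ‖ξ‖ := by
  have hclosed : IsClosed {ξ : formDomain hL hv hW |
      ‖formEmbed hL hv hW ξ - truncEmbed hL hv hW R ξ‖ ≤ L / (2 * Real.pi * (R + 1)) * ‖ξ‖} :=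
    isClosed_le (((formEmbed hL hv hW).continuous.sub (truncEmbed hL hv hW R).continuous).norm)
      (continuous_const.mul continuous_norm)
  have hsub : (coreRange hL hv hW : Set (formDomain hL hv hW)) ⊆ {ξ : formDomain hL hv hW |
      ‖formEmbed hL hv hW ξ - truncEmbed hL hv hW R ξ‖ ≤ L / (2 * Real.pi * (R + 1)) * ‖ξ‖} := by
    rintro ξ ⟨Ψ, hΨ⟩
    have hξ : ξ = ⟨graphEmbed hL hv hW Ψ, graphEmbed_mem_formDomain hL hv hW Ψ⟩ := Subtype.ext hΨ.symm
    rw [Set.mem_setOf_eq, hξ]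
    exact norm_formEmbed_sub_truncEmbed_le_core hL hv hW R Ψ
  have h := closure_minimal hsub hclosed
  rw [(dense_coreRange hL hv hW).closure_eq] at h
  exact h (Set.mem_univ ξ)

/-- The operator-norm form of the Rellich bound: `‖T_R - ι‖ ≤ L/(2π(R+1))`. [folklore] -/
theorem opNorm_truncEmbed_sub_formEmbed_le (hL : 0 < L) (hv : Measurable v)
    (hW : ∫⁻ X in cellN N L, periodicInteraction v L X ≠ ⊤) (R : ℕ) :
    ‖truncEmbed hL hv hW R - formEmbed hL hv hW‖ ≤ L / (2 * Real.pi * (R + 1)) :=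
  ContinuousLinearMap.opNorm_le_bound _ (by positivity) fun ξ => by
    have : (truncEmbed hL hv hW R - formEmbed hL hv hW) ξ =
        truncEmbed hL hv hW R ξ - formEmbed hL hv hW ξ := rfl
    rw [this, norm_sub_rev]
    exact norm_formEmbed_sub_truncEmbed_le hL hv hW R ξ

/-- The finite-rank truncations converge to the embedding in operator norm. [folklore] -/
theorem tendsto_truncEmbed (hL : 0 < L) (hv : Measurable v)
    (hW : ∫⁻ X in cellN N L, periodicInteraction v L X ≠ ⊤) :
    Tendsto (fun R => truncEmbed hL hv hW R) atTop (𝓝 (formEmbed hL hv hW)) := by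
  refine (tendsto_iff_norm_sub_tendsto_zero (f := fun R => truncEmbed hL hv hW R)
    (b := formEmbed hL hv hW)).2 ?_
  refine squeeze_zero (g := fun R : ℕ => L / (2 * Real.pi * (R + 1)))
    (fun R => norm_nonneg (truncEmbed hL hv hW R - formEmbed hL hv hW)) (fun R => ?_) ?_
  · exact opNorm_truncEmbed_sub_formEmbed_le hL hv hW R
  · have h := (tendsto_one_div_add_atTop_nhds_zero_nat (𝕜 := ℝ)).const_mul (L / (2 * Real.pi))
    rw [mul_zero] at h
    refine h.congr fun R => ?_
    rw [mul_one_div, div_div]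

/-- **Rellich's lemma for the periodic `N`-body form: the embedding `ι : Q → L²((ℝ/ℤ)^{3N})` is a
compact operator** (the Hamiltonian has compact resolvent): `ι` is the operator-norm limit of the
finite-rank truncations `T_R`. [cite: ReedSimonIV1978, Thm. XIII.64 and XIII.73–74] -/
theorem isCompactOperator_formEmbed (hL : 0 < L) (hv : Measurable v)
    (hW : ∫⁻ X in cellN N L, periodicInteraction v L X ≠ ⊤) :
    IsCompactOperator (formEmbed hL hv hW) :=
  isCompactOperator_of_tendsto (tendsto_truncEmbed hL hv hW)
    (Eventually.of_forall fun R => isCompactOperator_truncEmbed hL hv hW R)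

end Literature.MathematicalPhysics.QuantumManyBody.BoseGas
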